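/-
Copyright (c) 2026 the pub-hodgecm-mathlib formalisation cell (harness21).  Prover seat hodgecm-mathlib-F0P3a-p05 (g18): road «S3-ram» (LEAD F0P3a-plan (g13); owner∕table
F0P3a-p06 (g15); (Cnt2′) chair F0P3a-p07 (g14)), **ROW-1C IN RANK 2** — the W-side rank-one class dichotomy (A-p12 (g24) 2026-09-02T03:30:18Z open item (b)); 2026-09-02.
-/
import Literature.NumberTheory.Automorphic.UnitaryLatticeTreeRankOneVertexResidualToolsRamified   -- part 1 (this seat): §1 rank-2 residual algebra, §2 dimension-generic residue reading; brings ★ ROW-1C rank 3 and its ★ imports (G3⁗, G3⁺ `forall_v_conj_sub_one_le_iff_map_sub_one_le_scaleLattice`, FILE H `map_toLin'_latt_le_scaleLattice_iff`, `inv_mul_sq_mul_eq_sq`)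
import Literature.NumberTheory.Automorphic.UnitaryLatticeTreeSelfDualTransitiveTwo              -- ★ p848050 (this lineage, g17): rank-2 transitivity `exists_unitary_mapGL_stdLattice_eq_of_isSelfDualLattice_two_of_v_two`
import HarnessLib

/-!
# The lattice graph of a hermitian PLANE — ONE CLASS PER RANK-ONE VERTEX at a tamely ramified place (rank 2): at a `Γ`-fixed self-dual vertex of exact depth `d`
# and rank one the unit values `ϖ^{−d}·⟨y, (Γ − 1)y⟩` form ONE square class (Rogawski 1990 §4.9; Kottwitz 1986 §3; Bruhat–Tits 1972 §10; Tits 1979 §3.5)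

Topic `NumberTheory/Automorphic`; namespace `Literature.NumberTheory.Automorphic.UnitaryLatticeTree`.  THEOREMS ONLY (no definition, no instance, no notation, no named fact,
no `sorry`); kernel lane `--supports stmt-HodgeConjecture-24833`.  Cell `pub/hodgecm-mathlib` (D-0151), crux H413; road «S3-ram» (Literature seeding, count-neutral), the (T2)
G-side organ (Cnt2′) of F0P3a-p07 (g14): the W-side rows `1±` of a type-(2) element (right-hand sides of ★ (z1-e) `ncard_selfDual_fixed_axis_rankOne_{class,not_class}_eq`) are
counts of `Γ`-fixed self-dual lattices `B ⊂ W = K²` on the depth shell `LEV(ϖ^d) ∧ ¬LEV(ϖ^{d+1}) ∧ LEV₂(ϖ^{2d+1})` split by the CLASS TOKEN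
`CLS_d(t)(B) :⟺ ∃ y ∈ B, ∃ a ∈ 𝒪^×, |ϖ^{−d}⟨y, (Γ−1)y⟩ − t·a²| < 1`.  The ★ shell class law (A-p12 (g24) `natCard_class_eq_natCard_class_of_{even,odd}_depth_ramified`; lattice
form ★ p848350∕p848544 (p05), ★ p848542 (A-p12)) says every unit class is taken EQUALLY often; THIS FILE adds the DICHOTOMY that makes the two rows halves: at such a `B`, for a
unit `c` and a residual non-square unit `ε`, EXACTLY ONE of `CLS_d(c)`, `CLS_d(c·ε)` holds — the RANK-2 port of this lineage's ★ ROW-1C `class_xor_class_mul_of_selfDual_rankOne`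
(rank 3), over the residual tools of part 1 (`UnitaryLatticeTreeRankOneVertexResidualToolsRamified`):

* §2′ rank 2: the class token at `L₀` read residually (`exists_integer_eq_test_and_residue_eq_two`, `exists_mem_stdLattice_depthClass_iff_residue_two`).
* §3 rank 2: at EVEN `d` a rank-one vertex of exact depth `d` does not exist (`Ȳ` `J`-antisymmetric of square zero is `0`:
  `forall_v_coe_sub_one_le_succ_of_even_of_sq_le_two`); **`class_xor_class_mul_stdLattice_of_rankOne_two`** (matrix form at `L₀`) and
  **`class_xor_class_mul_of_selfDual_rankOne_two`** (vertex form at any `Γ`-fixed self-dual `B`, transitivity ★ p848050), and its form-keyed variant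
  `class_xor_class_mul_of_selfDual_rankOne_two_of_eq` (`H₂ = antidiag(1,1)` as a hypothesis, for consumers at a CM place: ★ `placeForm_antidiagOne`).

HONEST LABEL: HC_CM is proved only modulo the 2 remaining named inputs (hLiu418 24832, h413 24833) until rung 0 closes; nothing printed is asserted here (elementary algebra over a
valuation ring and a finite field); «S3-ram» has no books consequence.

## References
* [Rogawski1990] J. D. Rogawski, *Automorphic Representations of Unitary Groups in Three Variables*, Ann. of Math. Stud. 123 (1990), §4.9 pp. 54–55 (the two rank-one classes).
* [Kottwitz1986] R. E. Kottwitz, *Base change for unit elements of Hecke algebras*, Compositio Math. 60 (1986), §3 (counting fixed lattices by residual data).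
* [BruhatTits1972] F. Bruhat, J. Tits, *Groupes réductifs sur un corps local I*, Publ. Math. IHÉS 41 (1972), §10 (vertex stabilisers, congruence filtration, residual forms).
* [Tits1979] J. Tits, *Reductive groups over local fields*, PSPM 33.1 (1979), §3.5 (filtration quotients of a parahoric of a ramified unitary group).
-/

set_option autoImplicit false

noncomputable section

open scoped Valued WithZero Matrix MatrixGroups

namespace Literature.NumberTheory.Automorphic.UnitaryLatticeTree

open Literature.NumberTheory.Automorphic Literature.NumberTheory.Automorphic.HermitianLattice

variable {K : Type*} [Field K] [Valued K ℤᵐ⁰] {σ : K →+* K} {ϖ : K}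

/-! ## §2′ Rank 2: the class token at `L₀` read residually -/

/-- **RESIDUAL VALUE OF THE TEST, RANK 2**: for `x ∈ 𝒪²` and `Y₀ = (ϖ^d)⁻¹·M` integral, `(ϖ^d)⁻¹·B₀(x, Mx)` is an element `t ∈ 𝒪` with `residue t = ᵗx̄ (J̄ Ȳ) x̄`
(`σ̄ = id`).  Rank 3: ★ `exists_integer_eq_test_and_residue_eq`. [cite: Tits1979, §3.5] [cite: Kottwitz1986, §3] -/
theorem exists_integer_eq_test_and_residue_eq_two (hvσ : ∀ a, Valued.v (σ a) = Valued.v a) (hres : ∀ x : K, Valued.v x ≤ 1 → Valued.v (σ x - x) < 1)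
    (hϖ0 : ϖ ≠ 0) {d : ℕ} (M : Matrix (Fin 2) (Fin 2) K) (Y₀ : Matrix (Fin 2) (Fin 2) 𝒪[K])
    (hY₀ : ∀ i j, ((Y₀ i j : 𝒪[K]) : K) = (ϖ ^ d)⁻¹ * M i j) (x₀ : Fin 2 → 𝒪[K]) :
    ∃ t : 𝒪[K], (t : K) = (ϖ ^ d)⁻¹ * B₀ σ 2 (fun i => (x₀ i : K)) (M *ᵥ fun i => (x₀ i : K)) ∧
      IsLocalRing.residue 𝒪[K] t = (fun i => IsLocalRing.residue 𝒪[K] (x₀ i)) ⬝ᵥ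
        ((((StdForm.antidiagonal 2).over 𝓀[K]) * Y₀.map (IsLocalRing.residue 𝒪[K])) *ᵥ fun i => IsLocalRing.residue 𝒪[K] (x₀ i)) := by
  have hϖd : (ϖ ^ d : K) ≠ 0 := pow_ne_zero _ hϖ0
  have hM : M = (ϖ ^ d) • (Y₀.map (fun y : 𝒪[K] => (y : K))) := by
    ext i j
    rw [Matrix.smul_apply, Matrix.map_apply, hY₀, smul_eq_mul, mul_inv_cancel_left₀ hϖd]
  have hmv : M *ᵥ (fun i => (x₀ i : K)) = (ϖ ^ d) • ((Y₀.map (fun y : 𝒪[K] => (y : K))) *ᵥ (fun i => (x₀ i : K))) := by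
    rw [hM, Matrix.smul_mulVec]
  have hmap : (Y₀.map (fun y : 𝒪[K] => (y : K))) *ᵥ (fun i => (x₀ i : K)) = fun j => ((Y₀ *ᵥ x₀) j : K) := by
    ext j
    simp [Matrix.mulVec, dotProduct]
  refine ⟨∑ i, (⟨σ (x₀ i : K), map_coe_mem_integer hvσ (x₀ i)⟩ : 𝒪[K]) * (Y₀ *ᵥ x₀) (Fin.rev i), ?_, ?_⟩
  · rw [hmv, map_smul, smul_eq_mul, inv_mul_cancel_left₀ hϖd, hmap, B₀_apply]
    push_cast
    rfl
  · have hres' : (Y₀.map (IsLocalRing.residue 𝒪[K])) *ᵥ (fun i => IsLocalRing.residue 𝒪[K] (x₀ i)) = fun j => IsLocalRing.residue 𝒪[K] ((Y₀ *ᵥ x₀) j) := by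
      ext j
      simp [Matrix.mulVec, dotProduct]
    rw [map_sum, ← Matrix.mulVec_mulVec, dotProduct_antidiagonal_two_mulVec_eq_sum, hres']
    simp only [map_mul, residue_map_sigma_eq hvσ hres]

/-- **THE CLASS TOKEN AT `L₀` READ RESIDUALLY, RANK 2**: «some `x ∈ 𝒪²` has `|ϖ^{−d}·⟨x, Mx⟩ − t·a²| < 1` with `|a| = 1`» iff «some `x̄ ∈ 𝓀²` has
`ᵗx̄ (J̄Ȳ) x̄ = t̄·ā²` with `ā ≠ 0`» (rank 3: ★ `exists_mem_stdLattice_depthClass_iff_residue`). [cite: Tits1979, §3.5] [cite: Kottwitz1986, §3] [cite: Rogawski1990, §4.9 p. 55] -/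
theorem exists_mem_stdLattice_depthClass_iff_residue_two (hvσ : ∀ a, Valued.v (σ a) = Valued.v a) (hres : ∀ x : K, Valued.v x ≤ 1 → Valued.v (σ x - x) < 1)
    (hϖ : Valued.v ϖ = WithZero.exp (-1 : ℤ)) {d : ℕ} (M : Matrix (Fin 2) (Fin 2) K) (Y₀ : Matrix (Fin 2) (Fin 2) 𝒪[K])
    (hY₀ : ∀ i j, ((Y₀ i j : 𝒪[K]) : K) = (ϖ ^ d)⁻¹ * M i j) (t : K) (ht : Valued.v t ≤ 1) :
    (∃ x ∈ stdLattice K 2, ∃ a : K, Valued.v a = 1 ∧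
        Valued.v ((ϖ ^ d)⁻¹ * pairing σ ((StdForm.antidiagonal 2).over K) x (M *ᵥ x) - t * a ^ 2) < 1) ↔
      ∃ x : Fin 2 → 𝓀[K], ∃ a : 𝓀[K], a ≠ 0 ∧
        x ⬝ᵥ ((((StdForm.antidiagonal 2).over 𝓀[K]) * Y₀.map (IsLocalRing.residue 𝒪[K])) *ᵥ x) =
          IsLocalRing.residue 𝒪[K] ⟨t, (Valuation.mem_integer_iff _ _).2 ht⟩ * a ^ 2 := by
  have hϖ0 : ϖ ≠ 0 := fun h0 => by rw [h0, map_zero] at hϖ; exact WithZero.coe_ne_zero hϖ.symm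
  constructor
  · rintro ⟨x, hx, a, ha, hlt⟩
    set x₀ : Fin 2 → 𝒪[K] := fun i => ⟨x i, (Valuation.mem_integer_iff _ _).2 ((mem_stdLattice).1 hx i)⟩ with hx₀def
    obtain ⟨tt, htt, hrt⟩ := exists_integer_eq_test_and_residue_eq_two hvσ hres hϖ0 M Y₀ hY₀ x₀
    refine ⟨fun i => IsLocalRing.residue 𝒪[K] (x₀ i), ?_⟩
    rw [← hrt]
    refine (exists_unit_v_sub_mul_sq_lt_one_iff_residue tt ⟨t, (Valuation.mem_integer_iff _ _).2 ht⟩).1 ⟨a, ha, ?_⟩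
    rw [htt]
    rw [pairing_antidiagonal] at hlt
    exact hlt
  · rintro ⟨xb, a, ha, heq⟩
    choose x₀ hx₀ using fun i => IsLocalRing.residue_surjective (xb i)
    have hxb : (fun i => IsLocalRing.residue 𝒪[K] (x₀ i)) = xb := funext hx₀
    obtain ⟨tt, htt, hrt⟩ := exists_integer_eq_test_and_residue_eq_two hvσ hres hϖ0 M Y₀ hY₀ x₀
    rw [hxb] at hrt
    obtain ⟨a₀, ha₀, hlt⟩ := (exists_unit_v_sub_mul_sq_lt_one_iff_residue tt ⟨t, (Valuation.mem_integer_iff _ _).2 ht⟩).2 ⟨a, ha, by rw [hrt, heq]⟩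
    refine ⟨fun i => (x₀ i : K), (mem_stdLattice).2 fun i => (x₀ i).2, a₀, ha₀, ?_⟩
    rw [pairing_antidiagonal, ← htt]
    exact hlt

/-! ## §3 ONE CLASS PER RANK-ONE VERTEX, rank 2 -/

/-- **NO RANK-ONE VERTEX OF EXACT EVEN DEPTH IN RANK 2**: for `Γ ∈ U(σ, J₂)`, `Y = Γ − 1` of level `ϖ^d` with `d ≥ 1` EVEN and `Y²` of level `ϖ^{2d+1}`, all
`|Y_{ij}| ≤ |ϖ|^{d+1}` — the residual `Ȳ` is `J`-antisymmetric (`Ȳ₀₁ = Ȳ₁₀ = 0`, `Ȳ₁₁ = −Ȳ₀₀`) of square zero, hence `0` (rank 3: ★ `forall_v_coe_sub_one_le_succ_of_even_of_sq_le`).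
[cite: Tits1979, §3.5] [cite: Kottwitz1986, §3] -/
theorem forall_v_coe_sub_one_le_succ_of_even_of_sq_le_two (hvσ : ∀ z, Valued.v (σ z) = Valued.v z) (hσϖ : σ ϖ = -ϖ) (hϖ : Valued.v ϖ = WithZero.exp (-1 : ℤ))
    (hres : ∀ x : K, Valued.v x ≤ 1 → Valued.v (σ x - x) < 1) (h2 : Valued.v (2 : K) = 1)
    (γ : unitaryGroupOfForm σ ((StdForm.antidiagonal 2).over K)) {d : ℕ} (hd : Even d) (hd1 : 1 ≤ d)
    (hY : ∀ i j, Valued.v ((((γ : GL (Fin 2) K) : Matrix (Fin 2) (Fin 2) K) - 1) i j) ≤ Valued.v ϖ ^ d)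
    (hsq : ∀ i j, Valued.v (((((γ : GL (Fin 2) K) : Matrix (Fin 2) (Fin 2) K) - 1) * ((((γ : GL (Fin 2) K) : Matrix (Fin 2) (Fin 2) K) - 1))) i j) ≤ Valued.v ϖ ^ (2 * d + 1)) :
    ∀ i j, Valued.v ((((γ : GL (Fin 2) K) : Matrix (Fin 2) (Fin 2) K) - 1) i j) ≤ Valued.v ϖ ^ (d + 1) := by
  set Y : Matrix (Fin 2) (Fin 2) K := ((γ : GL (Fin 2) K) : Matrix (Fin 2) (Fin 2) K) - 1 with hYdef
  obtain ⟨Y₀, hY₀⟩ := exists_integer_matrix_eq_inv_pow_mul_fin hϖ Y hY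
  have hanti : ∀ i j, Y₀.map (IsLocalRing.residue 𝒪[K]) i j = -Y₀.map (IsLocalRing.residue 𝒪[K]) j.rev i.rev :=
    map_residue_apply_eq_neg_rev_of_add_le_fin hϖ Y Y₀ hY₀ (v_coe_sub_one_apply_add_rev_le_of_even_fin hvσ hσϖ hϖ hres γ hd hd1 hY)
  have hsq0 := map_residue_mul_self_eq_zero_of_sq_le_fin hϖ Y Y₀ hY₀ hsq
  -- residual characteristic is not `2`
  have h2k : (2 : 𝓀[K]) ≠ 0 := by
    intro h0
    have h0' : IsLocalRing.residue 𝒪[K] 2 = 0 := by rwa [map_ofNat]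
    rw [residue_eq_zero_iff_v_lt_one] at h0'
    have e2 : ((2 : 𝒪[K]) : K) = 2 := by norm_cast
    rw [e2, h2] at h0'
    exact lt_irrefl _ h0'
  -- the residual matrix vanishes
  set Z : Matrix (Fin 2) (Fin 2) 𝓀[K] := Y₀.map (IsLocalRing.residue 𝒪[K]) with hZdef
  have hr0 : (0 : Fin 2).rev = 1 := rfl
  have hr1 : (1 : Fin 2).rev = 0 := rfl
  have hZ01 : Z 0 1 = 0 := by
    have h := hanti 0 1; rw [hr0, hr1] at h
    have h' : (2 : 𝓀[K]) * Z 0 1 = 0 := by linear_combination h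
    exact (mul_eq_zero.1 h').resolve_left h2k
  have hZ10 : Z 1 0 = 0 := by
    have h := hanti 1 0; rw [hr0, hr1] at h
    have h' : (2 : 𝓀[K]) * Z 1 0 = 0 := by linear_combination h
    exact (mul_eq_zero.1 h').resolve_left h2k
  have e : ∀ i j, Z i 0 * Z 0 j + Z i 1 * Z 1 j = 0 := fun i j => by
    have h := congr_fun (congr_fun hsq0 i) j
    rwa [Matrix.mul_apply, Fin.sum_univ_two, Matrix.zero_apply] at h
  have hZ00 : Z 0 0 = 0 := by
    have h := e 0 0; rw [hZ01, zero_mul, add_zero] at h; exact mul_self_eq_zero.1 h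
  have hZ11 : Z 1 1 = 0 := by
    have h := e 1 1; rw [hZ10, zero_mul, zero_add] at h; exact mul_self_eq_zero.1 h
  have hZ0 : Z = 0 := by
    ext i j; fin_cases i <;> fin_cases j
    · exact hZ00
    · exact hZ01
    · exact hZ10
    · exact hZ11
  by_contra hne
  exact map_residue_ne_zero_of_not_forall_le_succ_fin hϖ Y Y₀ hY₀ hne hZ0

/-- **ONE CLASS AT THE ROOT, RANK 2 (matrix form).**  For `Γ ∈ U(σ, J₂)`, `Y = Γ − 1` with `|Y_{ij}| ≤ |ϖ|^d` (`d ≥ 1`), NOT all `≤ |ϖ|^{d+1}` (exact depth `d`) and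
`|(Y²)_{ij}| ≤ |ϖ|^{2d+1}` (rank one), a unit `c` and a residual non-square unit `ε`: EXACTLY ONE of the classes `c`, `c·ε` is taken by `x ↦ ϖ^{−d}·⟨x, Y x⟩` on `𝒪²` to first
order.  (`d` is odd by `forall_v_coe_sub_one_le_succ_of_even_of_sq_le_two`; the residual `Ȳ` is `J`-symmetric, non-zero of square zero: §1.)  Rank 3: ★
`class_xor_class_mul_stdLattice_of_rankOne`. [cite: Rogawski1990, §4.9 p. 55] [cite: Kottwitz1986, §3] [cite: Tits1979, §3.5] [cite: BruhatTits1972, §10] -/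
theorem class_xor_class_mul_stdLattice_of_rankOne_two (hvσ : ∀ a, Valued.v (σ a) = Valued.v a) (hσϖ : σ ϖ = -ϖ)
    (hϖ : Valued.v ϖ = WithZero.exp (-1 : ℤ)) (hres : ∀ x : K, Valued.v x ≤ 1 → Valued.v (σ x - x) < 1) (h2 : Valued.v (2 : K) = 1) [Finite 𝓀[K]]
    (γ : unitaryGroupOfForm σ ((StdForm.antidiagonal 2).over K)) {d : ℕ} (hd1 : 1 ≤ d)
    (hY : ∀ i j, Valued.v ((((γ : GL (Fin 2) K) : Matrix (Fin 2) (Fin 2) K) - 1) i j) ≤ Valued.v ϖ ^ d)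
    (hY' : ¬ ∀ i j, Valued.v ((((γ : GL (Fin 2) K) : Matrix (Fin 2) (Fin 2) K) - 1) i j) ≤ Valued.v ϖ ^ (d + 1))
    (hsq : ∀ i j, Valued.v (((((γ : GL (Fin 2) K) : Matrix (Fin 2) (Fin 2) K) - 1) * ((((γ : GL (Fin 2) K) : Matrix (Fin 2) (Fin 2) K) - 1))) i j) ≤ Valued.v ϖ ^ (2 * d + 1))
    (c ε : K) (hc : Valued.v c = 1) (hεv : Valued.v ε = 1) (hε : ∀ z : K, Valued.v z ≤ 1 → Valued.v (z ^ 2 - ε) = 1) :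
    ((∃ x ∈ stdLattice K 2, ∃ a : K, Valued.v a = 1 ∧
          Valued.v ((ϖ ^ d)⁻¹ * pairing σ ((StdForm.antidiagonal 2).over K) x ((((γ : GL (Fin 2) K) : Matrix (Fin 2) (Fin 2) K) - 1) *ᵥ x) - c * a ^ 2) < 1) ∨
        (∃ x ∈ stdLattice K 2, ∃ a : K, Valued.v a = 1 ∧
          Valued.v ((ϖ ^ d)⁻¹ * pairing σ ((StdForm.antidiagonal 2).over K) x ((((γ : GL (Fin 2) K) : Matrix (Fin 2) (Fin 2) K) - 1) *ᵥ x) - (c * ε) * a ^ 2) < 1)) ∧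
      ¬ ((∃ x ∈ stdLattice K 2, ∃ a : K, Valued.v a = 1 ∧
            Valued.v ((ϖ ^ d)⁻¹ * pairing σ ((StdForm.antidiagonal 2).over K) x ((((γ : GL (Fin 2) K) : Matrix (Fin 2) (Fin 2) K) - 1) *ᵥ x) - c * a ^ 2) < 1) ∧
          (∃ x ∈ stdLattice K 2, ∃ a : K, Valued.v a = 1 ∧
            Valued.v ((ϖ ^ d)⁻¹ * pairing σ ((StdForm.antidiagonal 2).over K) x ((((γ : GL (Fin 2) K) : Matrix (Fin 2) (Fin 2) K) - 1) *ᵥ x) - (c * ε) * a ^ 2) < 1)) := by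
  set Y : Matrix (Fin 2) (Fin 2) K := ((γ : GL (Fin 2) K) : Matrix (Fin 2) (Fin 2) K) - 1 with hYdef
  -- parity: `d` is odd
  have hodd : Odd d := by
    rcases Nat.even_or_odd d with hev | hodd
    · exact absurd (forall_v_coe_sub_one_le_succ_of_even_of_sq_le_two hvσ hσϖ hϖ hres h2 γ hev hd1 hY hsq) hY'
    · exact hodd
  -- residual characteristic is not `2`
  have h2k : (2 : 𝓀[K]) ≠ 0 := by
    intro h0
    have h0' : IsLocalRing.residue 𝒪[K] 2 = 0 := by rwa [map_ofNat]
    rw [residue_eq_zero_iff_v_lt_one] at h0'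
    have e2 : ((2 : 𝒪[K]) : K) = 2 := by norm_cast
    rw [e2, h2] at h0'
    exact lt_irrefl _ h0'
  -- the residual leading matrix
  obtain ⟨Y₀, hY₀⟩ := exists_integer_matrix_eq_inv_pow_mul_fin hϖ Y hY
  have hsymm : ∀ i j, Y₀.map (IsLocalRing.residue 𝒪[K]) i j = Y₀.map (IsLocalRing.residue 𝒪[K]) j.rev i.rev :=
    map_residue_apply_eq_rev_of_sub_le_fin hϖ Y Y₀ hY₀ (v_coe_sub_one_apply_sub_rev_le_of_odd_fin hvσ hσϖ hϖ hres γ hodd hY)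
  have hsq0 := map_residue_mul_self_eq_zero_of_sq_le_fin hϖ Y Y₀ hY₀ hsq
  have hne0 := map_residue_ne_zero_of_not_forall_le_succ_fin hϖ Y Y₀ hY₀ hY'
  -- residues of the constants
  have hcε : Valued.v (c * ε) ≤ 1 := by rw [map_mul, hc, hεv, one_mul]
  have hc0 : IsLocalRing.residue 𝒪[K] ⟨c, (Valuation.mem_integer_iff _ _).2 hc.le⟩ ≠ 0 := by
    rw [Ne, residue_eq_zero_iff_v_lt_one]
    exact fun h => (ne_of_lt h) hc
  have hεns : ¬ IsSquare (IsLocalRing.residue 𝒪[K] ⟨ε, (Valuation.mem_integer_iff _ _).2 hεv.le⟩) := by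
    rintro ⟨r, hr⟩
    obtain ⟨z, rfl⟩ := IsLocalRing.residue_surjective r
    have h1 := hε z z.2
    have h0 : IsLocalRing.residue 𝒪[K] (z ^ 2 - ⟨ε, (Valuation.mem_integer_iff _ _).2 hεv.le⟩) = 0 := by
      rw [map_sub, map_pow, hr, pow_two, sub_self]
    rw [residue_eq_zero_iff_v_lt_one] at h0
    push_cast at h0
    exact (ne_of_lt h0) h1
  have hmul : IsLocalRing.residue 𝒪[K] ⟨c * ε, (Valuation.mem_integer_iff _ _).2 hcε⟩ =
      IsLocalRing.residue 𝒪[K] ⟨c, (Valuation.mem_integer_iff _ _).2 hc.le⟩ * IsLocalRing.residue 𝒪[K] ⟨ε, (Valuation.mem_integer_iff _ _).2 hεv.le⟩ := by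
    rw [← map_mul]; rfl
  have hR := represents_xor_represents_mul_of_symm_of_mul_self_eq_zero_two h2k (Y₀.map (IsLocalRing.residue 𝒪[K])) hsymm hsq0 hne0 hc0 hεns
  rw [exists_mem_stdLattice_depthClass_iff_residue_two hvσ hres hϖ Y Y₀ hY₀ c hc.le, exists_mem_stdLattice_depthClass_iff_residue_two hvσ hres hϖ Y Y₀ hY₀ (c * ε) hcε, hmul]
  exact hR

/-- **ROW-1C IN RANK 2 — «ONE CLASS PER RANK-ONE VERTEX» on the W-side.**  At a self-dual lattice `B ⊂ K²` (for `(σ, ϖ, J₂)`) with, for `Γ ∈ U(σ, J₂)`, the tokens of exact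
depth `d ≥ 1` (`(Γ−1)B ⊆ ϖ^d B`, `¬ (Γ−1)B ⊆ ϖ^{d+1} B`) and rank one (`(Γ−1)²B ⊆ ϖ^{2d+1}B`), for a unit `c` and a residual non-square unit `ε`: EXACTLY ONE of the class
tokens `CLS_d(c)`, `CLS_d(c·ε)` holds, `CLS_d(t)(B) :⟺ ∃ y ∈ B, a ∈ 𝒪^×, |ϖ^{−d}⟨y, (Γ−1)y⟩ − t·a²| < 1` — the depth-`d` unit values form ONE square class.  (`B = u·L₀` by ★
rank-2 transitivity `exists_unitary_mapGL_stdLattice_eq_of_isSelfDualLattice_two_of_v_two`, then the matrix form for `u⁻¹Γu`.)  With the ★ shell class law this makes the W-side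
rows `1+` and `1−` HALVES of their shell.  Rank 3: ★ `class_xor_class_mul_of_selfDual_rankOne`.
[cite: Rogawski1990, §4.9 p. 55] [cite: Kottwitz1986, §3] [cite: Tits1979, §3.5] [cite: BruhatTits1972, §10] -/
theorem class_xor_class_mul_of_selfDual_rankOne_two (hσ : ∀ x, σ (σ x) = x) (hvσ : ∀ a, Valued.v (σ a) = Valued.v a) (hσϖ : σ ϖ = -ϖ)
    (hϖ : Valued.v ϖ = WithZero.exp (-1 : ℤ)) (hres : ∀ x : K, Valued.v x ≤ 1 → Valued.v (σ x - x) < 1) (h2 : Valued.v (2 : K) = 1) [Finite 𝓀[K]]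
    (γ : unitaryGroupOfForm σ ((StdForm.antidiagonal 2).over K))
    {B : Submodule 𝒪[K] (Fin 2 → K)} (hB : IsSelfDualLattice σ ϖ ((StdForm.antidiagonal 2).over K) B)
    {d : ℕ} (hd1 : 1 ≤ d)
    (hlev : B.map ((Matrix.toLin' (((γ : GL (Fin 2) K) : Matrix (Fin 2) (Fin 2) K) - 1)).restrictScalars 𝒪[K]) ≤ scaleLattice (ϖ ^ d) B)
    (hlev' : ¬ B.map ((Matrix.toLin' (((γ : GL (Fin 2) K) : Matrix (Fin 2) (Fin 2) K) - 1)).restrictScalars 𝒪[K]) ≤ scaleLattice (ϖ ^ (d + 1)) B)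
    (hrk : B.map ((Matrix.toLin' ((((γ : GL (Fin 2) K) : Matrix (Fin 2) (Fin 2) K) - 1) ^ 2)).restrictScalars 𝒪[K]) ≤ scaleLattice (ϖ ^ (2 * d + 1)) B)
    (c ε : K) (hc : Valued.v c = 1) (hεv : Valued.v ε = 1) (hε : ∀ z : K, Valued.v z ≤ 1 → Valued.v (z ^ 2 - ε) = 1) :
    ((∃ y ∈ B, ∃ a : K, Valued.v a = 1 ∧ Valued.v ((ϖ ^ d)⁻¹ * pairing σ ((StdForm.antidiagonal 2).over K) y ((((γ : GL (Fin 2) K) : Matrix (Fin 2) (Fin 2) K) - 1) *ᵥ y) - c * a ^ 2) < 1) ∨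
        (∃ y ∈ B, ∃ a : K, Valued.v a = 1 ∧ Valued.v ((ϖ ^ d)⁻¹ * pairing σ ((StdForm.antidiagonal 2).over K) y ((((γ : GL (Fin 2) K) : Matrix (Fin 2) (Fin 2) K) - 1) *ᵥ y) - (c * ε) * a ^ 2) < 1)) ∧
      ¬ ((∃ y ∈ B, ∃ a : K, Valued.v a = 1 ∧ Valued.v ((ϖ ^ d)⁻¹ * pairing σ ((StdForm.antidiagonal 2).over K) y ((((γ : GL (Fin 2) K) : Matrix (Fin 2) (Fin 2) K) - 1) *ᵥ y) - c * a ^ 2) < 1) ∧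
        (∃ y ∈ B, ∃ a : K, Valued.v a = 1 ∧ Valued.v ((ϖ ^ d)⁻¹ * pairing σ ((StdForm.antidiagonal 2).over K) y ((((γ : GL (Fin 2) K) : Matrix (Fin 2) (Fin 2) K) - 1) *ᵥ y) - (c * ε) * a ^ 2) < 1)) := by
  have hϖ0 : ϖ ≠ 0 := fun h0 => by rw [h0, map_zero] at hϖ; exact WithZero.coe_ne_zero hϖ.symm
  -- `B = u·L₀`
  obtain ⟨u, hu⟩ := exists_unitary_mapGL_stdLattice_eq_of_isSelfDualLattice_two_of_v_two hσ hvσ hϖ h2 hB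
  subst hu
  -- the tokens as matrix bounds on `Γ′ − 1`, `Γ′ = u⁻¹Γu`
  have hY : ∀ i j, Valued.v (((((u⁻¹ * γ * u : unitaryGroupOfForm σ ((StdForm.antidiagonal 2).over K)) : GL (Fin 2) K) : Matrix (Fin 2) (Fin 2) K) - 1) i j) ≤ Valued.v ϖ ^ d :=
    fun i j => by rw [← map_pow]; exact (forall_v_conj_sub_one_le_iff_map_sub_one_le_scaleLattice γ u (pow_ne_zero _ hϖ0)).1 hlev i j
  have hY' : ¬ ∀ i j, Valued.v (((((u⁻¹ * γ * u : unitaryGroupOfForm σ ((StdForm.antidiagonal 2).over K)) : GL (Fin 2) K) : Matrix (Fin 2) (Fin 2) K) - 1) i j) ≤ Valued.v ϖ ^ (d + 1) :=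
    fun h => hlev' ((forall_v_conj_sub_one_le_iff_map_sub_one_le_scaleLattice γ u (pow_ne_zero _ hϖ0)).2 fun i j => by rw [map_pow]; exact h i j)
  have hu' : IsUnit ((u : GL (Fin 2) K) : Matrix (Fin 2) (Fin 2) K).det := Matrix.isUnits_det_units _
  have hconj : ((u : GL (Fin 2) K) : Matrix (Fin 2) (Fin 2) K)⁻¹ * (((γ : GL (Fin 2) K) : Matrix (Fin 2) (Fin 2) K) - 1) * ((u : GL (Fin 2) K) : Matrix (Fin 2) (Fin 2) K) =
      (((u⁻¹ * γ * u : unitaryGroupOfForm σ ((StdForm.antidiagonal 2).over K)) : GL (Fin 2) K) : Matrix (Fin 2) (Fin 2) K) - 1 := by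
    rw [coe_inv_mul_mul_sub_one_fin, Matrix.coe_units_inv]
  have hrk' : (latt ((u : GL (Fin 2) K) : Matrix (Fin 2) (Fin 2) K)).map ((Matrix.toLin' ((((γ : GL (Fin 2) K) : Matrix (Fin 2) (Fin 2) K) - 1) ^ 2)).restrictScalars 𝒪[K]) ≤
      scaleLattice (ϖ ^ (2 * d + 1)) (latt ((u : GL (Fin 2) K) : Matrix (Fin 2) (Fin 2) K)) := hrk
  rw [map_toLin'_latt_le_scaleLattice_iff (pow_ne_zero _ hϖ0) _ hu', inv_mul_sq_mul_eq_sq _ hu', hconj] at hrk'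
  have hsq : ∀ i j, Valued.v ((((((u⁻¹ * γ * u : unitaryGroupOfForm σ ((StdForm.antidiagonal 2).over K)) : GL (Fin 2) K) : Matrix (Fin 2) (Fin 2) K) - 1) *
      ((((u⁻¹ * γ * u : unitaryGroupOfForm σ ((StdForm.antidiagonal 2).over K)) : GL (Fin 2) K) : Matrix (Fin 2) (Fin 2) K) - 1)) i j) ≤ Valued.v ϖ ^ (2 * d + 1) :=
    fun i j => by rw [← pow_two, ← map_pow]; exact hrk' i j
  have h1 := class_xor_class_mul_stdLattice_of_rankOne_two hvσ hσϖ hϖ hres h2 (u⁻¹ * γ * u) hd1 hY hY' hsq c ε hc hεv hε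
  have e1 := exists_mem_mapGL_stdLattice_depthClass_iff_fin u γ ((ϖ ^ d)⁻¹) c
  have e2 := exists_mem_mapGL_stdLattice_depthClass_iff_fin u γ ((ϖ ^ d)⁻¹) (c * ε)
  rw [e1, e2]
  exact h1

/-- **ROW-1C IN RANK 2, form-keyed variant**: the same dichotomy for any form `H₂` GIVEN as `antidiag(1,1)` by an equation (so a consumer whose form is spelled differently —
e.g. `placeForm Φ₂ w` at a CM place, ★ `placeForm_antidiagOne` — applies it without transporting the unitary group). [cite: Rogawski1990, §4.9 p. 55] [cite: Kottwitz1986, §3] -/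
theorem class_xor_class_mul_of_selfDual_rankOne_two_of_eq (hσ : ∀ x, σ (σ x) = x) (hvσ : ∀ a, Valued.v (σ a) = Valued.v a) (hσϖ : σ ϖ = -ϖ)
    (hϖ : Valued.v ϖ = WithZero.exp (-1 : ℤ)) (hres : ∀ x : K, Valued.v x ≤ 1 → Valued.v (σ x - x) < 1) (h2 : Valued.v (2 : K) = 1) [Finite 𝓀[K]]
    {H₂ : Matrix (Fin 2) (Fin 2) K} (hH : H₂ = (StdForm.antidiagonal 2).over K) (γ : unitaryGroupOfForm σ H₂)
    {B : Submodule 𝒪[K] (Fin 2 → K)} (hB : IsSelfDualLattice σ ϖ H₂ B)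
    {d : ℕ} (hd1 : 1 ≤ d)
    (hlev : B.map ((Matrix.toLin' (((γ : GL (Fin 2) K) : Matrix (Fin 2) (Fin 2) K) - 1)).restrictScalars 𝒪[K]) ≤ scaleLattice (ϖ ^ d) B)
    (hlev' : ¬ B.map ((Matrix.toLin' (((γ : GL (Fin 2) K) : Matrix (Fin 2) (Fin 2) K) - 1)).restrictScalars 𝒪[K]) ≤ scaleLattice (ϖ ^ (d + 1)) B)
    (hrk : B.map ((Matrix.toLin' ((((γ : GL (Fin 2) K) : Matrix (Fin 2) (Fin 2) K) - 1) ^ 2)).restrictScalars 𝒪[K]) ≤ scaleLattice (ϖ ^ (2 * d + 1)) B)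
    (c ε : K) (hc : Valued.v c = 1) (hεv : Valued.v ε = 1) (hε : ∀ z : K, Valued.v z ≤ 1 → Valued.v (z ^ 2 - ε) = 1) :
    ((∃ y ∈ B, ∃ a : K, Valued.v a = 1 ∧ Valued.v ((ϖ ^ d)⁻¹ * pairing σ H₂ y ((((γ : GL (Fin 2) K) : Matrix (Fin 2) (Fin 2) K) - 1) *ᵥ y) - c * a ^ 2) < 1) ∨
        (∃ y ∈ B, ∃ a : K, Valued.v a = 1 ∧ Valued.v ((ϖ ^ d)⁻¹ * pairing σ H₂ y ((((γ : GL (Fin 2) K) : Matrix (Fin 2) (Fin 2) K) - 1) *ᵥ y) - (c * ε) * a ^ 2) < 1)) ∧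
      ¬ ((∃ y ∈ B, ∃ a : K, Valued.v a = 1 ∧ Valued.v ((ϖ ^ d)⁻¹ * pairing σ H₂ y ((((γ : GL (Fin 2) K) : Matrix (Fin 2) (Fin 2) K) - 1) *ᵥ y) - c * a ^ 2) < 1) ∧
        (∃ y ∈ B, ∃ a : K, Valued.v a = 1 ∧ Valued.v ((ϖ ^ d)⁻¹ * pairing σ H₂ y ((((γ : GL (Fin 2) K) : Matrix (Fin 2) (Fin 2) K) - 1) *ᵥ y) - (c * ε) * a ^ 2) < 1)) := by
  subst hH
  exact class_xor_class_mul_of_selfDual_rankOne_two hσ hvσ hσϖ hϖ hres h2 γ hB hd1 hlev hlev' hrk c ε hc hεv hε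

end Literature.NumberTheory.Automorphic.UnitaryLatticeTree

end
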